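import Summits.MatrixMultiplication.OmegaCensus.SmallFormats.MatMul22nRankGF7Slack4RelData1
import Summits.MatrixMultiplication.OmegaCensus.SmallFormats.MatMul22nRankGF7PatternDFS
import Summits.MatrixMultiplication.OmegaCensus.SmallFormats.MatMul22nRankGF7DotProduct
import HarnessLib

/-!
# ω-census family (a): semantics of the relation certificates and of the packed coefficient vectors (slack-4 search, step S1)

Cell `pub-omega` (unit `pub-omega-tensor-g15`), topic `Summits/MatrixMultiplication/OmegaCensus` (sub-folder `SmallFormats`).
Framing (verbatim): lottery ticket; floor = certified bounds/negative ranges. HONEST FRAMING: kernel infrastructure — the first lemmas of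
the soundness proof of the search checker (`pub-omega-tensor-g15/KERNEL-S4-DESIGN.md` §7 (i)–(iii)); nothing here is progress on `ω`.

* `freeIdx7_ok`: the 73 free coordinates are pairwise distinct and `< 882`.
* `relCoef7 u d` = the coefficient function of the functional `mkRelA7 u d` (`1` at `u`, `(7 − d t) % 7` at `freeIdx7 t`);
  `mkRelA7_eq_pack3`, `fld3_mkRelA7`: its base-8 digits; `relVal7_mkRelA7`: the functional evaluates to
  `P u + Σ_t ((7 − d t) % 7)·P (freeIdx7 t)` where `P u = xrs7 x (cosetRow7 (u/42) (u%42))`.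
* `relEv7 u d tt`: the packed REVERSED coefficient vector on torus `tt` (the search checker's `relE7` with the relation data abstracted);
  `relEv7_eq_pack10`, and `dot_relEv7`: `dotPack10 (pack10 p 42) (relEv7 u d tt) = Σ_{z<42} p z · relCoef7 u d (42·tt + z)` for `p ≤ 4`.
-/

namespace Summit.MatrixMultiplication.OmegaCensus.SmallFormats

open Finset
open Literature.NumberTheory.NumberFields (list_sum_range_map)

/-! ## The free coordinates -/

set_option maxRecDepth 100000 in
/-- The 73 free coordinates are `< 882` and pairwise distinct. -/
theorem freeIdx7_ok : (∀ t : Fin 73, freeIdx7 t.val < 882) ∧ ∀ t t' : Fin 73, freeIdx7 t.val = freeIdx7 t'.val → t = t' := by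
  refine ⟨by decide, by decide⟩

/-- At most one free index hits a given coordinate. -/
theorem card_free_fiber7 (u' : ℕ) : ((range 73).filter fun t => freeIdx7 t = u').card ≤ 1 := by
  rw [Finset.card_le_one_iff]
  intro a b ha hb
  rw [mem_filter, mem_range] at ha hb
  have := freeIdx7_ok.2 ⟨a, ha.1⟩ ⟨b, hb.1⟩ (ha.2.trans hb.2.symm)
  simpa using this

/-! ## The coefficient function of `mkRelA7` -/

/-- Coefficient of coordinate `u'` in the functional `mkRelA7 u d`. -/
def relCoef7 (u : ℕ) (d : ℕ → ℕ) (u' : ℕ) : ℕ :=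
  (if u' = u then 1 else 0) + ∑ t ∈ range 73, if freeIdx7 t = u' then (7 - d t) % 7 else 0

/-- The free part of a coefficient is `≤ 6`. -/
theorem relCoef7_free_le (d : ℕ → ℕ) (u' : ℕ) : ∑ t ∈ range 73, (if freeIdx7 t = u' then (7 - d t) % 7 else 0) ≤ 6 := by
  rw [← sum_filter]
  calc ∑ t ∈ (range 73).filter (fun t => freeIdx7 t = u'), (7 - d t) % 7
      ≤ ∑ _t ∈ (range 73).filter (fun t => freeIdx7 t = u'), 6 := sum_le_sum fun t _ => by omega
    _ = ((range 73).filter fun t => freeIdx7 t = u').card * 6 := by rw [sum_const, smul_eq_mul]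
    _ ≤ 1 * 6 := Nat.mul_le_mul_right _ (card_free_fiber7 u')
    _ = 6 := by norm_num

/-- Off the free set, the free part at `u` vanishes. -/
theorem relCoef7_free_zero {u : ℕ} (hu : ∀ t < 73, freeIdx7 t ≠ u) (d : ℕ → ℕ) :
    ∑ t ∈ range 73, (if freeIdx7 t = u then (7 - d t) % 7 else 0) = 0 :=
  sum_eq_zero fun t ht => by rw [if_neg (hu t (mem_range.1 ht))]

/-- Coefficients are `≤ 6` (hence digits in any base `≥ 7`). -/
theorem relCoef7_le {u : ℕ} (hu : ∀ t < 73, freeIdx7 t ≠ u) (d : ℕ → ℕ) (u' : ℕ) : relCoef7 u d u' ≤ 6 := by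
  unfold relCoef7
  by_cases h : u' = u
  · rw [if_pos h, h, relCoef7_free_zero hu]; norm_num
  · rw [if_neg h]; have := relCoef7_free_le d u'; omega

/-- `mkRelA7 u d` is the base-8 packing of its coefficient function (`u < 882`). -/
theorem mkRelA7_eq_pack3 {u : ℕ} (hu882 : u < 882) (d : ℕ → ℕ) : mkRelA7 u d = pack3 (relCoef7 u d) 882 := by
  have h1 : (2 : ℕ) ^ (3 * u) = ∑ u' ∈ range 882, (if u' = u then 1 else 0) * 2 ^ (3 * u') := by
    rw [show (∑ u' ∈ range 882, (if u' = u then 1 else 0) * 2 ^ (3 * u'))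
        = ∑ u' ∈ range 882, (if u' = u then 1 * 2 ^ (3 * u') else 0) from
          sum_congr rfl fun u' _ => by split_ifs <;> simp,
      sum_ite_eq' (range 882) u, if_pos (mem_range.2 hu882), one_mul]
  have h2 : ((List.range 73).map fun t => (7 - d t) % 7 * 2 ^ (3 * freeIdx7 t)).sum
      = ∑ u' ∈ range 882, (∑ t ∈ range 73, if freeIdx7 t = u' then (7 - d t) % 7 else 0) * 2 ^ (3 * u') := by
    rw [list_sum_range_map]
    have e : ∀ t ∈ range 73, (7 - d t) % 7 * 2 ^ (3 * freeIdx7 t)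
        = ∑ u' ∈ range 882, (if freeIdx7 t = u' then (7 - d t) % 7 * 2 ^ (3 * u') else 0) := by
      intro t ht
      rw [sum_ite_eq (range 882) (freeIdx7 t), if_pos (mem_range.2 (freeIdx7_ok.1 ⟨t, mem_range.1 ht⟩))]
    rw [sum_congr rfl e, sum_comm]
    refine sum_congr rfl fun u' _ => ?_
    rw [sum_mul]
    exact sum_congr rfl fun t _ => by split_ifs <;> simp
  unfold mkRelA7 pack3
  rw [h1, h2, ← sum_add_distrib]
  exact sum_congr rfl fun u' _ => by unfold relCoef7; ring

/-- Digits of `mkRelA7`: `fld 3 (mkRelA7 u d) u' = relCoef7 u d u'` (`u, u' < 882`, `u` off the free set). -/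
theorem fld3_mkRelA7 {u : ℕ} (hu882 : u < 882) (hu : ∀ t < 73, freeIdx7 t ≠ u) (d : ℕ → ℕ) {u' : ℕ} (hu' : u' < 882) :
    fld 3 (mkRelA7 u d) u' = relCoef7 u d u' := by
  rw [fld3_eq, mkRelA7_eq_pack3 hu882, pack3_digit _ (fun i _ => by have := relCoef7_le hu d i; omega) hu']

/-- **Meaning of the functional `mkRelA7 u d`:** `relVal7 (mkRelA7 u d) x = P u + Σ_t ((7 − d t) % 7)·P (freeIdx7 t)`. -/
theorem relVal7_mkRelA7 {u : ℕ} (hu882 : u < 882) (hu : ∀ t < 73, freeIdx7 t ≠ u) (d : ℕ → ℕ) (x : ℕ → ℕ) :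
    relVal7 (mkRelA7 u d) x = xrs7 x (cosetRow7 (u / 42) (u % 42))
      + ∑ t ∈ range 73, (((7 - d t) % 7 : ℕ) : ℤ) * xrs7 x (cosetRow7 (freeIdx7 t / 42) (freeIdx7 t % 42)) := by
  unfold relVal7
  set P : ℕ → ℤ := fun u' => xrs7 x (cosetRow7 (u' / 42) (u' % 42)) with hP
  have e : ∀ u' ∈ range 882, (fld 3 (mkRelA7 u d) u' : ℤ) * P u'
      = (if u' = u then P u' else 0) + ∑ t ∈ range 73, (if freeIdx7 t = u' then (((7 - d t) % 7 : ℕ) : ℤ) * P u' else 0) := by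
    intro u' hu'
    rw [fld3_mkRelA7 hu882 hu d (mem_range.1 hu')]
    unfold relCoef7
    simp only [Nat.cast_add, Nat.cast_sum, Nat.cast_ite, Nat.cast_one, Nat.cast_zero, add_mul, sum_mul, ite_mul, one_mul,
      zero_mul]
  rw [sum_congr rfl e, sum_add_distrib, sum_ite_eq' (range 882) u, if_pos (mem_range.2 hu882), sum_comm]
  have e2 : ∀ t ∈ range 73, ∑ u' ∈ range 882, (if freeIdx7 t = u' then (((7 - d t) % 7 : ℕ) : ℤ) * P u' else 0)
      = (((7 - d t) % 7 : ℕ) : ℤ) * P (freeIdx7 t) := by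
    intro t ht
    rw [sum_ite_eq (range 882) (freeIdx7 t), if_pos (mem_range.2 (freeIdx7_ok.1 ⟨t, mem_range.1 ht⟩))]
  rw [sum_congr rfl e2]

/-! ## The packed reversed coefficient vectors -/

/-- The checker's packed reversed coefficient vector of `mkRelA7 u d` on torus `tt` (digit `41 − z` = coefficient of coordinate `42·tt + z`). -/
def relEv7 (u : ℕ) (d : ℕ → ℕ) (tt : ℕ) : ℕ :=
  ((List.range 73).map fun t => if freeIdx7 t / 42 = tt then (7 - d t) % 7 * 2 ^ (10 * (41 - freeIdx7 t % 42)) else 0).sum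
    + (if u / 42 = tt then 2 ^ (10 * (41 - u % 42)) else 0)

/-- A sum over the 42 coordinates of a torus picks out the coordinate `w` when `w` lies in that torus. -/
theorem sum_coord7 (tt w : ℕ) (g : ℕ → ℕ) :
    ∑ z ∈ range 42, (if 42 * tt + z = w then g z else 0) = if w / 42 = tt then g (w % 42) else 0 := by
  by_cases h : w / 42 = tt
  · rw [if_pos h]
    have hw : w % 42 < 42 := Nat.mod_lt _ (by norm_num)
    rw [sum_eq_single (w % 42)]
    · rw [if_pos (by rw [← h]; exact Nat.div_add_mod w 42)]
    · intro z hz hne; rw [if_neg]; intro heq; apply hne; omega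
    · intro hn; exact absurd (mem_range.2 hw) hn
  · rw [if_neg h]
    exact sum_eq_zero fun z hz => by rw [if_neg]; intro heq; apply h; have := mem_range.1 hz; omega

/-- `relEv7` is the base-`2^10` packing of the reversed coefficient vector. -/
theorem relEv7_eq_pack10 (u : ℕ) (d : ℕ → ℕ) (tt : ℕ) :
    relEv7 u d tt = pack10 (fun z' => relCoef7 u d (42 * tt + (41 - z'))) 42 := by
  unfold pack10
  -- reflect the index
  rw [show (∑ i ∈ range 42, relCoef7 u d (42 * tt + (41 - i)) * 2 ^ (10 * i))
      = ∑ z ∈ range 42, relCoef7 u d (42 * tt + z) * 2 ^ (10 * (41 - z)) by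
    rw [← sum_range_reflect (fun i => relCoef7 u d (42 * tt + (41 - i)) * 2 ^ (10 * i)) 42]
    refine sum_congr rfl fun z hz => ?_
    have := mem_range.1 hz
    simp only [show 42 - 1 - z = 41 - z by omega, show 41 - (41 - z) = z by omega]]
  unfold relEv7 relCoef7
  -- the u-term
  have h1 : (if u / 42 = tt then 2 ^ (10 * (41 - u % 42)) else 0)
      = ∑ z ∈ range 42, (if 42 * tt + z = u then 1 else 0) * 2 ^ (10 * (41 - z)) := by
    rw [← sum_coord7 tt u (fun z => 2 ^ (10 * (41 - z)))]
    exact sum_congr rfl fun z _ => by split_ifs <;> simp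
  -- the free terms
  have h2 : ((List.range 73).map fun t => if freeIdx7 t / 42 = tt then (7 - d t) % 7 * 2 ^ (10 * (41 - freeIdx7 t % 42)) else 0).sum
      = ∑ z ∈ range 42, (∑ t ∈ range 73, if freeIdx7 t = 42 * tt + z then (7 - d t) % 7 else 0) * 2 ^ (10 * (41 - z)) := by
    rw [list_sum_range_map]
    have e : ∀ t ∈ range 73, (if freeIdx7 t / 42 = tt then (7 - d t) % 7 * 2 ^ (10 * (41 - freeIdx7 t % 42)) else 0)
        = ∑ z ∈ range 42, (if 42 * tt + z = freeIdx7 t then (7 - d t) % 7 * 2 ^ (10 * (41 - z)) else 0) := by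
      intro t _; rw [sum_coord7 tt (freeIdx7 t) (fun z => (7 - d t) % 7 * 2 ^ (10 * (41 - z)))]
    rw [sum_congr rfl e, sum_comm]
    refine sum_congr rfl fun z _ => ?_
    rw [sum_mul]
    refine sum_congr rfl fun t _ => ?_
    by_cases hq : freeIdx7 t = 42 * tt + z
    · rw [if_pos hq.symm, if_pos hq]
    · rw [if_neg (fun h => hq h.symm), if_neg hq, zero_mul]
  rw [h1, h2, ← sum_add_distrib]
  refine sum_congr rfl fun z _ => ?_
  ring

/-- **The checker's dot product.** For a column `p ≤ 4` and a relation off the free set: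
`dotPack10 (pack10 p 42) (relEv7 u d tt) = Σ_{z<42} p z · relCoef7 u d (42·tt + z)`. -/
theorem dot_relEv7 {u : ℕ} (hu : ∀ t < 73, freeIdx7 t ≠ u) (d : ℕ → ℕ) (tt : ℕ) (p : ℕ → ℕ) (hp : ∀ z < 42, p z ≤ 4) :
    dotPack10 (pack10 p 42) (relEv7 u d tt) = ∑ z ∈ range 42, p z * relCoef7 u d (42 * tt + z) := by
  rw [relEv7_eq_pack10]
  have e : (fun z' => relCoef7 u d (42 * tt + (41 - z'))) = fun i => (fun z => relCoef7 u d (42 * tt + z)) (41 - i) := rfl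
  rw [e]
  exact dotPack10_eq p (fun z => relCoef7 u d (42 * tt + z)) hp (fun z _ => relCoef7_le hu d _)

end Summit.MatrixMultiplication.OmegaCensus.SmallFormats
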